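import Literature.MathematicalPhysics.QuantumLattice.FinDimSpectrumGibbsLimitProofs
import Mathlib.Analysis.Normed.Algebra.MatrixExponential
import Mathlib.Analysis.SpecialFunctions.Exponential
import Mathlib.Analysis.SpecialFunctions.Log.Basic

/-!
# The model-independent form of the descent `LogColdToGround` is false
# (crux stmt-HubbardSuperconductivity-8808, route `LogColdTorus`; helper of line `registered`)

The DESCENT crux `Theses.LogColdTorus.LogColdToGround` asks: if the sector Gibbs state of the torus
Hubbard model at the LOG-COLD inverse temperature `β_L = κ log L` carries d-wave pair order `c·L⁴`
for every `κ ≥ κ₀` (eventually in `L`, the threshold `L₀` depending on `κ`), does the sector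
ground-state functional carry order `c'·L⁴`?  Its informal text and the registered line
(`Cruxes/LogColdToGround/Lines/birth.lean`) name as sufficient mechanism the thermodynamic
monotonicity `d/dβ ω_β(Δ_d†Δ_d) = -Cov_β(H, Δ_d†Δ_d) ≥ 0` below `T_L`.

This file records, kernel-checked, why NO argument using only finite-dimensionality, hermiticity,
positivity and the log-cold hypothesis can prove the crux (so that every future line must bring
Hubbard-specific control of the paired phase between `T_L = 1/(κ log L)` and `T = 0`):

* `toyH N = diag(0, 1, …, 1)` on `Fin (N + 1)` (unique ground state, spectral gap `1`), observable
  `c • toyH N`; `gibbsState_toyH_smul`: `ω_β(c • H) = c · N e^{-β} / (1 + N e^{-β})`;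
  `groundStateFunctional_toyH_smul`: `ω₀(c • H) = 0` (zero-temperature limit of the former,
  `Matrix.tendsto_gibbsState_atTop_holds`).
* `toy_logCold_order`: with `N = 2^{L²}` (the entropy of a many-body sector) and `c = L⁴`, the
  log-cold hypothesis holds with constant `1/2` for EVERY `κ ≥ 0` as soon as
  `L ≥ ⌈κ / log 2⌉₊ + 1`: the Boltzmann factor of the unit gap at `β = κ log L` is only `L^{-κ}`,
  and `L^κ ≤ 2^{L²}` (`exp_mul_log_le_two_pow`).
* `abstract_logColdDescent_false`: hence the model-independent strengthening of the crux (same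
  quantifier shape: `∀ κ ≥ κ₀ ∃ L₀ ∀ L ≥ L₀` order `≥ c L⁴` ⇒ `∃ c' > 0 ∃ L₁ ∀ L ≥ L₁` ground-state
  order `≥ c' L⁴`) is FALSE.  In the toy `Cov_β(H, A) = L⁴ Var_β(H) > 0` at every `β`, i.e. the
  named mechanism fails at all temperatures although the ground state is gapped and non-degenerate.

Reading: at `β = κ log L` excitation energy `E` is suppressed only polynomially (`L^{-κE}`) while
densities of states are exponential in the volume, so the log-cold state is an extensive-excitation-
energy state (`0 ≤ ω_β(H) - E₀ ≤ log(dim)/β`, the tree's `Matrix.re_gibbsState_hamiltonian_le`);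
descending to `E₀` is a statement about every excitation-energy density in between.

Sources: H. Tasaki, *Physics and Mathematics of Quantum Many-Body Systems* (2020), App. A (finite-
dimensional Gibbs states and their `β → ∞` limit); O. Bratteli, D. W. Robinson, *Operator Algebras
and QSM II*, §5.3.1.  The toy is folklore ("entropy versus Boltzmann factor"); re-entrance proper
(order at intermediate temperatures only) is rigorous in frustrated Ising models, H. Kitatani,
S. Miyashita, M. Suzuki, J. Phys. Soc. Jpn. 55 (1986) 865.
-/

noncomputable section

namespace Summit.HubbardSuperconductivity.LogColdToGround.Toy

open Matrix Filter Topology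
open scoped ComplexOrder

/-- Energy levels of the toy (local notation, not a definition): ground level `0` at index `0`,
a degenerate band at level `1`. -/
local notation3 "lev" => fun (N : ℕ) (i : Fin (N + 1)) => (if i = 0 then (0 : ℝ) else 1)

/-- The toy Hamiltonian `diag(0, 1, …, 1)` on `N + 1` states (local notation, not a definition). -/
local notation3 "toyH " N => (Matrix.diagonal fun i : Fin (N + 1) => ((lev N i : ℝ) : ℂ))

/-- The toy Hamiltonian is Hermitian (real diagonal). -/
theorem toyH_isHermitian (N : ℕ) : (toyH N).IsHermitian := by
  rw [isHermitian_diagonal_iff]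
  intro i
  rw [IsSelfAdjoint, Complex.star_def, Complex.conj_ofReal]

/-- The toy Hamiltonian is positive semidefinite (levels `0`, `1`). -/
theorem toyH_posSemidef (N : ℕ) : (toyH N).PosSemidef := by
  rw [posSemidef_diagonal_iff]
  intro i
  simp only
  split_ifs <;> simp

/-- The Gibbs weight of the toy is diagonal with entries `e^{-β·lev i}`. -/
theorem gibbsWeight_toyH (β : ℝ) (N : ℕ) :
    gibbsWeight β (toyH N) = diagonal fun i => (Real.exp (-β * lev N i) : ℂ) := by
  rw [gibbsWeight, smul_eq_diagonal_mul, diagonal_mul_diagonal, exp_diagonal]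
  congr 1
  funext i
  rw [Pi.exp_def]
  simp only
  rw [← Complex.exp_eq_exp_ℂ, Complex.ofReal_exp]
  congr 1
  push_cast
  ring

/-- The ground level is `0`. -/
@[simp] theorem lev_zero (N : ℕ) : lev N 0 = 0 := by simp

/-- Every other level is `1`. -/
@[simp] theorem lev_succ (N : ℕ) (i : Fin N) : lev N i.succ = 1 := by simp [Fin.succ_ne_zero]

/-- `Z(β) = 1 + N e^{-β}`. -/
theorem partitionFn_toyH (β : ℝ) (N : ℕ) :
    partitionFn β (toyH N) = ((1 + N * Real.exp (-β) : ℝ) : ℂ) := by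
  rw [partitionFn, gibbsWeight_toyH, trace_diagonal, Fin.sum_univ_succ]
  simp [Finset.sum_const, Finset.card_univ]

/-- `Tr(e^{-βH} H) = N e^{-β}`. -/
theorem trace_gibbsWeight_mul_toyH (β : ℝ) (N : ℕ) :
    (gibbsWeight β (toyH N) * toyH N).trace = ((N * Real.exp (-β) : ℝ) : ℂ) := by
  rw [gibbsWeight_toyH, diagonal_mul_diagonal, trace_diagonal, Fin.sum_univ_succ]
  simp [Finset.sum_const, Finset.card_univ]

/-- The Gibbs expectation of `c • H` in the toy: `c · N e^{-β} / (1 + N e^{-β})`. -/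
theorem gibbsState_toyH_smul (β : ℝ) (N : ℕ) (c : ℝ) :
    gibbsState β (toyH N) ((c : ℂ) • toyH N) =
      ((c * (N * Real.exp (-β)) / (1 + N * Real.exp (-β)) : ℝ) : ℂ) := by
  rw [gibbsState_apply, Matrix.mul_smul, trace_smul, trace_gibbsWeight_mul_toyH, partitionFn_toyH,
    smul_eq_mul]
  push_cast
  ring

/-- The toy Gibbs expectation of `c • H` tends to `0` as `β → ∞`. -/
theorem tendsto_gibbsState_toyH_smul (N : ℕ) (c : ℝ) :
    Tendsto (fun β : ℝ => gibbsState β (toyH N) ((c : ℂ) • toyH N)) atTop (𝓝 0) := by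
  have h0 : Tendsto (fun β : ℝ => Real.exp (-β)) atTop (𝓝 0) := Real.tendsto_exp_neg_atTop_nhds_zero
  have hnum : Tendsto (fun β : ℝ => c * (N * Real.exp (-β))) atTop (𝓝 (c * (N * 0))) :=
    (h0.const_mul _).const_mul _
  have hden : Tendsto (fun β : ℝ => 1 + N * Real.exp (-β)) atTop (𝓝 (1 + N * 0)) :=
    (h0.const_mul _).const_add _
  have hq' : Tendsto (fun β : ℝ => c * (N * Real.exp (-β)) / (1 + N * Real.exp (-β))) atTop
      (𝓝 (c * (N * 0) / (1 + N * 0))) := hnum.div hden (by simp)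
  have hq : Tendsto (fun β : ℝ => c * (N * Real.exp (-β)) / (1 + N * Real.exp (-β))) atTop (𝓝 0) := by
    simpa using hq'
  have hC := (Complex.continuous_ofReal.tendsto 0).comp hq
  simp only [Function.comp_def, Complex.ofReal_zero] at hC
  refine hC.congr fun β => ?_
  rw [gibbsState_toyH_smul]

/-- The tracial ground-state expectation of `c • H` in the toy vanishes (the ground state is the
single level `0`, on which `H = 0`). -/
theorem groundStateFunctional_toyH_smul (N : ℕ) (c : ℝ) :
    (toyH N).groundStateFunctional ((c : ℂ) • toyH N) = 0 :=
  tendsto_nhds_unique (tendsto_gibbsState_atTop_holds (toyH_isHermitian N) _)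
    (tendsto_gibbsState_toyH_smul N c)

/-- Log-cold entropy beats a unit gap: `L^κ ≤ 2^{L²}` as soon as `κ ≤ L · log 2` (`L ≥ 1`). -/
theorem exp_mul_log_le_two_pow {κ : ℝ} {L : ℕ} (hL : 1 ≤ L) (hκ : 0 ≤ κ) (hκL : κ ≤ L * Real.log 2) :
    Real.exp (κ * Real.log L) ≤ (2 : ℝ) ^ (L ^ 2) := by
  have hLpos : (0 : ℝ) < L := by exact_mod_cast hL
  have hlog : Real.log L ≤ L := (Real.log_le_sub_one_of_pos hLpos).trans (by linarith)
  have h1 : κ * Real.log L ≤ (L : ℝ) ^ 2 * Real.log 2 := by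
    calc κ * Real.log L ≤ κ * L := mul_le_mul_of_nonneg_left hlog hκ
      _ ≤ (L * Real.log 2) * L := mul_le_mul_of_nonneg_right hκL hLpos.le
      _ = (L : ℝ) ^ 2 * Real.log 2 := by ring
  calc Real.exp (κ * Real.log L) ≤ Real.exp ((L : ℝ) ^ 2 * Real.log 2) := Real.exp_le_exp.mpr h1
    _ = (2 : ℝ) ^ (L ^ 2) := by
      rw [show ((L : ℝ) ^ 2 * Real.log 2) = ((L ^ 2 : ℕ) : ℝ) * Real.log 2 by push_cast; ring,
        Real.exp_nat_mul, Real.exp_log two_pos]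

/-- In the toy family `H_L = toyH (2^{L²})`, `A_L = L⁴ • H_L` the LOG-COLD ORDER hypothesis holds with
`c = 1/2` for every `κ ≥ 0`: `(1/2)·L⁴ ≤ Re ω_{κ log L}(A_L)` for all `L ≥ ⌈κ / log 2⌉₊ + 1`. -/
theorem toy_logCold_order {κ : ℝ} (hκ : 0 ≤ κ) {L : ℕ} (hL : ⌈κ / Real.log 2⌉₊ + 1 ≤ L) :
    (1 / 2 : ℝ) * (L : ℝ) ^ 4 ≤
      (gibbsState (κ * Real.log L) (toyH (2 ^ (L ^ 2)))
        ((((L : ℝ) ^ 4 : ℝ) : ℂ) • toyH (2 ^ (L ^ 2)))).re := by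
  rw [gibbsState_toyH_smul, Complex.ofReal_re]
  have hL1 : 1 ≤ L := le_trans (Nat.le_add_left 1 _) hL
  have hlog2 : 0 < Real.log 2 := Real.log_pos one_lt_two
  have hκL : κ ≤ L * Real.log 2 := by
    have h1 : κ / Real.log 2 ≤ ⌈κ / Real.log 2⌉₊ := Nat.le_ceil _
    have h2 : (⌈κ / Real.log 2⌉₊ : ℝ) ≤ L := by exact_mod_cast le_trans (Nat.le_succ _) hL
    rw [div_le_iff₀ hlog2] at h1
    nlinarith
  set x : ℝ := ((2 ^ (L ^ 2) : ℕ) : ℝ) * Real.exp (-(κ * Real.log L)) with hx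
  have hx1 : 1 ≤ x := by
    have hN : ((2 ^ (L ^ 2) : ℕ) : ℝ) = (2 : ℝ) ^ (L ^ 2) := by push_cast; ring
    have hE := exp_mul_log_le_two_pow hL1 hκ hκL
    rw [hx, hN, Real.exp_neg]
    rw [← div_eq_mul_inv, le_div_iff₀ (Real.exp_pos _), one_mul]
    exact hE
  have hfrac : (1 / 2 : ℝ) ≤ x / (1 + x) := by
    rw [div_le_div_iff₀ (by norm_num) (by linarith)]
    linarith
  have hL4 : (0 : ℝ) ≤ (L : ℝ) ^ 4 := by positivity
  calc (1 / 2 : ℝ) * (L : ℝ) ^ 4 = (L : ℝ) ^ 4 * (1 / 2) := by ring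
    _ ≤ (L : ℝ) ^ 4 * (x / (1 + x)) := mul_le_mul_of_nonneg_left hfrac hL4
    _ = (L : ℝ) ^ 4 * x / (1 + x) := (mul_div_assoc _ _ _).symm

/-- **The model-independent form of the descent `LogColdToGround` is false.**  There is NO theorem of
the shape "for Hermitian `H_L` and positive semidefinite `A_L` on finite index sets, log-cold order
`c·L⁴ ≤ Re ω_{κ log L}(A_L)` for every `κ ≥ κ₀ > 0` (eventually in `L`, threshold depending on `κ`)
implies ground-state order `c'·L⁴ ≤ Re ω₀(A_L)` eventually": the two-level-band family
`H_L = diag(0, 1, …, 1)` on `2^{L²} + 1` states, `A_L = L⁴ • H_L` satisfies the hypothesis with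
`c = 1/2` for every `κ` (entropy `L² log 2` beats the Boltzmann factor `L^{-κ}` of the unit gap),
while its ground-state order is `0`.  Any proof of the crux must therefore use Hubbard-specific
structure between `T_L = 1/(κ log L)` and `T = 0`. -/
theorem abstract_logColdDescent_false :
    ¬ ∀ (n : ℕ → ℕ) (H A : ∀ L : ℕ, Matrix (Fin (n L)) (Fin (n L)) ℂ),
        (∀ L, (H L).IsHermitian) → (∀ L, (A L).PosSemidef) →
        ∀ (κ₀ c : ℝ), 0 < κ₀ → 0 < c →
        (∀ κ : ℝ, κ₀ ≤ κ → ∃ L₀ : ℕ, ∀ L : ℕ, L₀ ≤ L →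
            c * (L : ℝ) ^ 4 ≤ (Matrix.gibbsState (κ * Real.log L) (H L) (A L)).re) →
        ∃ c' : ℝ, 0 < c' ∧ ∃ L₁ : ℕ, ∀ L : ℕ, L₁ ≤ L →
            c' * (L : ℝ) ^ 4 ≤ ((H L).groundStateFunctional (A L)).re := by
  intro h
  have key := h (fun L => 2 ^ (L ^ 2) + 1) (fun L => toyH (2 ^ (L ^ 2)))
    (fun L => (((L : ℝ) ^ 4 : ℝ) : ℂ) • toyH (2 ^ (L ^ 2))) (fun L => toyH_isHermitian _)
    (fun L => (toyH_posSemidef _).smul (Complex.zero_le_real.mpr (by positivity))) 1 (1 / 2) one_pos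
    (by norm_num) (fun κ hκ => ⟨⌈κ / Real.log 2⌉₊ + 1, fun L hL => toy_logCold_order (by linarith) hL⟩)
  obtain ⟨c', hc', L₁, hL₁⟩ := key
  have hbad := hL₁ (max L₁ 1) (le_max_left _ _)
  rw [groundStateFunctional_toyH_smul, Complex.zero_re] at hbad
  have hpos : (0 : ℝ) < c' * ((max L₁ 1 : ℕ) : ℝ) ^ 4 := by
    have : (1 : ℝ) ≤ ((max L₁ 1 : ℕ) : ℝ) := by exact_mod_cast le_max_right L₁ 1
    positivity
  linarith

end Summit.HubbardSuperconductivity.LogColdToGround.Toy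

end
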